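import Summits.Ventures.PercRepro.Conditioning

/-!
# Expectations: one-edge conditioning and monotonicity in the edge probabilities

The expectation analogues of `prob_split` and `prob_mono_of_isUpperSet`:

* `expect_split`: `E_p[f] = p_e · E_{p[e:=1]}[f] + (1 - p_e) · E_{p[e:=0]}[f]`;
* `expect_update`: `E_{p[e:=x]}[f]` is affine in `x`;
* `expect_update_one_sub_expect_update_zero`:
  `E_{p[e:=1]}[f] - E_{p[e:=0]}[f] = ∑_{ω : e open} w_{p∖e}(ω) · (f ω - f (flipEdge e ω))`;
* `expect_mono_of_monotone`: for an increasing random variable `f` and `p ≤ p'` pointwise,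
  `E_p[f] ≤ E_{p'}[f]` (and `expect_anti_of_antitone` for decreasing `f`) — the function form
  of the monotonicity of increasing events (Grimmett, *Percolation*, Thm 2.1 / eq. (2.13)).
-/

open Finset

namespace PercRepro

variable {E : Type*} [Fintype E] [DecidableEq E]

/-- **Conditioning on one edge**, expectation form:
`E_p[f] = p_e · E_{p[e:=1]}[f] + (1 - p_e) · E_{p[e:=0]}[f]`. -/
theorem expect_split (p : E → ℝ) (e : E) (f : Config E → ℝ) :
    expect p f = p e * expect (Function.update p e 1) f
      + (1 - p e) * expect (Function.update p e 0) f := by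
  unfold expect
  rw [Finset.mul_sum, Finset.mul_sum, ← Finset.sum_add_distrib]
  refine Finset.sum_congr rfl fun ω _ => ?_
  rw [weight_split p e ω]
  ring

/-- `E_{p[e:=x]}[f] = x · E_{p[e:=1]}[f] + (1 - x) · E_{p[e:=0]}[f]`. -/
theorem expect_update (p : E → ℝ) (e : E) (x : ℝ) (f : Config E → ℝ) :
    expect (Function.update p e x) f =
      x * expect (Function.update p e 1) f + (1 - x) * expect (Function.update p e 0) f := by
  have h := expect_split (Function.update p e x) e f
  rwa [Function.update_idem, Function.update_idem, Function.update_self] at h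

/-- `E_{p[e:=1]}[f] = ∑_{ω : e open} w_{p∖e}(ω) · f ω`. -/
theorem expect_update_one_eq_sum (p : E → ℝ) (e : E) (f : Config E → ℝ) :
    expect (Function.update p e 1) f =
      ∑ ω, if ω e = true then weightErase p e ω * f ω else 0 := by
  unfold expect
  refine Finset.sum_congr rfl fun ω _ => ?_
  rw [weight_update_one]
  cases ω e <;> simp

/-- `E_{p[e:=0]}[f] = ∑_{ω : e open} w_{p∖e}(ω) · f (flipEdge e ω)` (re-indexed by the flip). -/
theorem expect_update_zero_eq_sum (p : E → ℝ) (e : E) (f : Config E → ℝ) :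
    expect (Function.update p e 0) f =
      ∑ ω, if ω e = true then weightErase p e ω * f (flipEdge e ω) else 0 := by
  unfold expect
  rw [← (flipEdge_involutive e).bijective.sum_comp]
  refine Finset.sum_congr rfl fun ω _ => ?_
  rw [weight_update_zero, weightErase_flipEdge]
  cases h : ω e <;> simp [h]

/-- **The slope in `p_e`**:
`E_{p[e:=1]}[f] - E_{p[e:=0]}[f] = ∑_{ω : e open} w_{p∖e}(ω) · (f ω - f (flipEdge e ω))`. -/
theorem expect_update_one_sub_expect_update_zero (p : E → ℝ) (e : E) (f : Config E → ℝ) :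
    expect (Function.update p e 1) f - expect (Function.update p e 0) f =
      ∑ ω, if ω e = true then weightErase p e ω * (f ω - f (flipEdge e ω)) else 0 := by
  rw [expect_update_one_eq_sum, expect_update_zero_eq_sum, ← Finset.sum_sub_distrib]
  refine Finset.sum_congr rfl fun ω _ => ?_
  cases ω e <;> simp [mul_sub]

/-- For an increasing random variable, surely opening `e` beats surely closing it:
`E_{p[e:=0]}[f] ≤ E_{p[e:=1]}[f]`. -/
theorem expect_update_zero_le_expect_update_one {p : E → ℝ} (hp : IsProb p) (e : E)
    {f : Config E → ℝ} (hf : Monotone f) :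
    expect (Function.update p e 0) f ≤ expect (Function.update p e 1) f := by
  rw [← sub_nonneg, expect_update_one_sub_expect_update_zero]
  refine Finset.sum_nonneg fun ω _ => ?_
  by_cases h : ω e = true
  · rw [if_pos h]
    exact mul_nonneg (weightErase_nonneg hp e ω)
      (sub_nonneg.2 (hf (flipEdge_le_of_eq_true h)))
  · rw [if_neg h]

/-- Raising one edge probability cannot decrease the expectation of an increasing random
variable. -/
theorem expect_le_expect_update {p : E → ℝ} (hp : IsProb p) (e : E) {x : ℝ} (hx : p e ≤ x)
    {f : Config E → ℝ} (hf : Monotone f) :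
    expect p f ≤ expect (Function.update p e x) f := by
  rw [expect_split p e f, expect_update p e x f]
  nlinarith [mul_nonneg (sub_nonneg.2 hx)
    (sub_nonneg.2 (expect_update_zero_le_expect_update_one hp e hf))]

/-- **Monotonicity in the edge probabilities, function form**: for an increasing random variable
`f` and `p ≤ p'` pointwise, `E_p[f] ≤ E_{p'}[f]`. -/
theorem expect_mono_of_monotone {p p' : E → ℝ} (hp : IsProb p) (hp' : IsProb p') (hle : p ≤ p')
    {f : Config E → ℝ} (hf : Monotone f) : expect p f ≤ expect p' f := by
  have key : ∀ S : Finset E, expect p f ≤ expect (fun e => if e ∈ S then p' e else p e) f := by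
    intro S
    induction S using Finset.induction_on with
    | empty => simp
    | insert e S he ih =>
      refine ih.trans ?_
      have hq : IsProb (fun e => if e ∈ S then p' e else p e) := fun e => by
        by_cases h : e ∈ S
        · simpa [h] using hp' e
        · simpa [h] using hp e
      have h := expect_le_expect_update hq e (x := p' e) (by simpa [he] using hle e) hf
      have hfun : Function.update (fun e => if e ∈ S then p' e else p e) e (p' e) =
          fun e' => if e' ∈ insert e S then p' e' else p e' := by
        funext e'
        by_cases h' : e' = e
        · subst h'
          simp
        · simp [h']
      rw [hfun] at h
      exact h
  simpa using key univ

/-- Monotonicity in the edge probabilities for a decreasing random variable: `p ≤ p'` gives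
`E_{p'}[f] ≤ E_p[f]`. -/
theorem expect_anti_of_antitone {p p' : E → ℝ} (hp : IsProb p) (hp' : IsProb p') (hle : p ≤ p')
    {f : Config E → ℝ} (hf : Antitone f) : expect p' f ≤ expect p f := by
  have h := expect_mono_of_monotone hp hp' hle (f := fun ω => -f ω)
    (fun _ _ hab => neg_le_neg (hf hab))
  have h1 : expect p (fun ω => -f ω) = -expect p f := by
    simp [expect, Finset.sum_neg_distrib]
  have h2 : expect p' (fun ω => -f ω) = -expect p' f := by
    simp [expect, Finset.sum_neg_distrib]
  rw [h1, h2] at h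
  linarith

omit [Fintype E] [DecidableEq E] in
/-- The indicator of an increasing event is an increasing random variable. -/
theorem monotone_indicator_one_of_isUpperSet {A : Set (Config E)} (hA : IsUpperSet A) :
    Monotone (A.indicator (1 : Config E → ℝ)) := by
  intro ω ω' h
  by_cases hω : ω ∈ A
  · simp [Set.indicator_of_mem hω, Set.indicator_of_mem (hA h hω)]
  · rw [Set.indicator_of_notMem hω]
    exact Set.indicator_nonneg (fun _ _ => zero_le_one) ω'

end PercRepro
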